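import Mathlib.RingTheory.Valuation.ValuationSubring
import HarnessLib

/-!
# A separating unit for finitely many pairwise incomparable rank-one valuation rings

Topic: `Literature/AlgebraicGeometry/Resolution` (valued function fields). Groundwork for the
algebraization step of M. Temkin, *Inseparable local uniformization*, J. Algebra 373 (2013) =
arXiv:0804.1554v3, Thm. 3.3.1 (tree: the named fact `Temkin2013RelativeCurveSmoothFibre`): in the
algebraic proof an element `w` of the finite extension `L ⊇ F` of valued function fields has to be
made INTEGRAL over `O_F` (all its conjugates in `O_V`) and simultaneously SMALL at the finitely
many places of `L` over the place of the coordinate field `l₀(x)` other than the given one; both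
are achieved by multiplying `w` by a power of one element `s ∈ L` which is a unit at the given
place `W₀` and lies in the maximal ideal of each of the finitely many other places `W₁, …, W_n`.
This is the approximation theorem for independent valuations (N. Bourbaki, *Alg. comm.* VI §7
no. 2, Cor. 1 of Th. 1) in the weak form needed, proved by the Artin–Whaples induction: first an
element `z` with `|z|_{W₀} > 1` and `|z|_{Wᵢ} < 1` for all `i` (pairwise step `z = b/a` with
`a ∈ W₀ ∖ Wᵢ`, `b ∈ Wᵢ ∖ W₀`; induction through `z′ᴺ z₁` or `z′ᴺ z₁/(1 + z′ᴺ)`, using that the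
`Wᵢ` have archimedean value groups), then `s = z/(1 + z)`.

* `exists_one_lt_valuation_and_lt_one` — the pairwise step — PROVED;
* `exists_one_lt_valuation_and_forall_lt_one` — `z` for a finite family — PROVED;
* `exists_valuation_eq_one_and_forall_lt_one` — **the separating unit `s`: `|s|_{W₀} = 1`,
  `|s|_{Wᵢ} < 1`** — PROVED;
* `archimedean_mul_of_forall_le_pow` — the archimedean hypothesis in the form used here, from the
  rank-one form "`|b| ≤ |a|ⁿ` for some `n` whenever `|a| > 1`" (Kuhlmann's definition of rank one
  through the value group, as in the tree's `IsRankOneValued`) — PROVED;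
* `not_le_of_forall_le_imp` — incomparability of two distinct valuation rings from the maximality
  of one of them among proper valuation subrings (height one) — PROVED.

All statements are [folklore] / Bourbaki; no definitions, no named facts.

## Sources

* N. Bourbaki, *Algèbre commutative*, Ch. VI §7 no. 1 Prop. 1, no. 2 Th. 1 and Cor. 1
  (independence and approximation for valuations).
* E. Artin, G. Whaples, *Axiomatic characterization of fields by the product formula for
  valuations*, Bull. AMS 51 (1945), Thm. 1 (the induction used here).
-/

noncomputable section

namespace Literature.AlgebraicGeometry.Resolution

universe u

variable {L : Type u} [Field L]

/-! ### Elementary valuation bookkeeping -/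

section Bookkeeping

variable (W : ValuationSubring L)

/-- `|1 + z| = |z|` when `|z| > 1`. [folklore] -/
theorem valuation_one_add_eq_of_one_lt {z : L} (hz : 1 < W.valuation z) :
    W.valuation (1 + z) = W.valuation z := by
  rw [add_comm]
  exact Valuation.map_add_eq_of_lt_left _ (by rwa [map_one])

/-- `|1 + z| = 1` when `|z| < 1`. [folklore] -/
theorem valuation_one_add_eq_one_of_lt_one {z : L} (hz : W.valuation z < 1) :
    W.valuation (1 + z) = 1 := by
  rw [← W.valuation.map_one (R := L)] at hz ⊢
  exact Valuation.map_add_eq_of_lt_left _ hz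

/-- `1 + z ≠ 0` when `|z| > 1` for some valuation. [folklore] -/
theorem one_add_ne_zero_of_one_lt {z : L} (hz : 1 < W.valuation z) : 1 + z ≠ 0 := by
  intro h0
  have h := valuation_one_add_eq_of_one_lt W hz
  rw [h0, map_zero] at h
  exact (lt_trans zero_lt_one hz).ne h

/-- `|z / (1 + z)| = 1` when `|z| > 1`. [folklore] -/
theorem valuation_div_one_add_eq_one_of_one_lt {z : L} (hz : 1 < W.valuation z) :
    W.valuation (z / (1 + z)) = 1 := by
  have hz0 : W.valuation z ≠ 0 := (lt_trans zero_lt_one hz).ne'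
  rw [map_div₀, valuation_one_add_eq_of_one_lt W hz, div_self hz0]

/-- `|z / (1 + z)| = |z|` when `|z| < 1`. [folklore] -/
theorem valuation_div_one_add_eq_of_lt_one {z : L} (hz : W.valuation z < 1) :
    W.valuation (z / (1 + z)) = W.valuation z := by
  rw [map_div₀, valuation_one_add_eq_one_of_lt_one W hz, div_one]

/-- `|zᴺ / (1 + zᴺ)| = 1` when `|z| > 1` (`N ≥ 1`). [folklore] -/
theorem valuation_pow_div_one_add_pow_eq_one_of_one_lt {z : L} (hz : 1 < W.valuation z) {N : ℕ}
    (hN : 1 ≤ N) : W.valuation (z ^ N / (1 + z ^ N)) = 1 := by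
  refine valuation_div_one_add_eq_one_of_one_lt W ?_
  rw [map_pow]
  exact one_lt_pow₀ hz (Nat.one_le_iff_ne_zero.mp hN)

/-- `|zᴺ / (1 + zᴺ)| = |z|ᴺ` when `|z| < 1` (`N ≥ 1`). [folklore] -/
theorem valuation_pow_div_one_add_pow_eq_of_lt_one {z : L} (hz : W.valuation z < 1) {N : ℕ}
    (hN : 1 ≤ N) : W.valuation (z ^ N / (1 + z ^ N)) = W.valuation z ^ N := by
  rw [← map_pow]
  refine valuation_div_one_add_eq_of_lt_one W ?_
  rw [map_pow]
  exact pow_lt_one₀ zero_le hz (Nat.one_le_iff_ne_zero.mp hN)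

end Bookkeeping

/-! ### The Artin–Whaples induction -/

section Approximation

/-- **Pairwise step.** For incomparable valuation rings `W₀`, `W` of `L` there is `z ∈ L` with
`|z|_{W₀} > 1` and `|z|_W < 1`: `z = b/a` with `a ∈ W₀ ∖ W`, `b ∈ W ∖ W₀`. [folklore] -/
theorem exists_one_lt_valuation_and_lt_one {W₀ W : ValuationSubring L} (h₀ : ¬W₀ ≤ W)
    (h₁ : ¬W ≤ W₀) : ∃ z : L, 1 < W₀.valuation z ∧ W.valuation z < 1 := by
  obtain ⟨a, ha₀, haW⟩ := Set.not_subset.mp h₀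
  obtain ⟨b, hbW, hb₀⟩ := Set.not_subset.mp h₁
  have ha₀' : W₀.valuation a ≤ 1 := (W₀.valuation_le_one_iff a).mpr ha₀
  have haW' : 1 < W.valuation a := lt_of_not_ge fun h => haW ((W.valuation_le_one_iff a).mp h)
  have hbW' : W.valuation b ≤ 1 := (W.valuation_le_one_iff b).mpr hbW
  have hb₀' : 1 < W₀.valuation b := lt_of_not_ge fun h => hb₀ ((W₀.valuation_le_one_iff b).mp h)
  have ha0 : a ≠ 0 := fun h => by
    rw [h, map_zero] at haW'
    exact not_lt_of_ge zero_le haW'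
  have hva₀ : W₀.valuation a ≠ 0 := by rwa [Ne, Valuation.zero_iff]
  have hvaW : W.valuation a ≠ 0 := by rwa [Ne, Valuation.zero_iff]
  refine ⟨b / a, ?_, ?_⟩
  · rw [map_div₀]
    -- `|b| > 1 ≥ |a|` at `W₀`
    rw [one_lt_div₀ ((Valuation.pos_iff _).mpr ha0)]
    exact lt_of_le_of_lt ha₀' hb₀'
  · rw [map_div₀, div_lt_one₀ ((Valuation.pos_iff _).mpr ha0)]
    exact lt_of_le_of_lt hbW' haW'

/-- **An element large at `W₀` and small at all `W ∈ 𝒲`** (Artin–Whaples): `W₀` non-trivial,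
each `W ∈ 𝒲` incomparable with `W₀` and with archimedean value group (in the form: for
`|x|_W < 1` and any `y` some `|xᴺ y|_W < 1`). [folklore] -/
theorem exists_one_lt_valuation_and_forall_lt_one [DecidableEq (ValuationSubring L)]
    (W₀ : ValuationSubring L) (h₀ : ∃ t : L, 1 < W₀.valuation t)
    (𝒲 : Finset (ValuationSubring L)) (hinc : ∀ W ∈ 𝒲, ¬W₀ ≤ W ∧ ¬W ≤ W₀)
    (harch : ∀ W ∈ 𝒲, ∀ x y : L, W.valuation x < 1 → ∃ N : ℕ, W.valuation (x ^ N * y) < 1) :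
    ∃ z : L, 1 < W₀.valuation z ∧ ∀ W ∈ 𝒲, W.valuation z < 1 := by
  induction 𝒲 using Finset.induction_on with
  | empty =>
    obtain ⟨t, ht⟩ := h₀
    exact ⟨t, ht, fun W hW => absurd hW (Finset.notMem_empty W)⟩
  | insert W 𝒲 hW ih =>
    obtain ⟨z', hz'₀, hz'⟩ := ih (fun U hU => hinc U (Finset.mem_insert_of_mem hU))
      (fun U hU => harch U (Finset.mem_insert_of_mem hU))
    obtain ⟨z₁, hz₁₀, hz₁W⟩ := exists_one_lt_valuation_and_lt_one (hinc W (Finset.mem_insert_self W 𝒲)).1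
      (hinc W (Finset.mem_insert_self W 𝒲)).2
    -- a uniform exponent `N ≥ 1` with `|z'ᴺ z₁|_U < 1` for all `U ∈ 𝒲`
    have hN : ∃ N : ℕ, 1 ≤ N ∧ ∀ U ∈ 𝒲, U.valuation (z' ^ N * z₁) < 1 := by
      classical
      choose! Nf hNf using fun U (hU : U ∈ 𝒲) => harch U (Finset.mem_insert_of_mem hU) z' z₁ (hz' U hU)
      refine ⟨(𝒲.sup Nf) + 1, Nat.le_add_left 1 _, fun U hU => ?_⟩
      have hle : Nf U ≤ 𝒲.sup Nf + 1 := (Finset.le_sup hU).trans (Nat.le_succ _)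
      -- increasing the exponent only decreases the value since `|z'|_U < 1`
      have hzU : U.valuation z' < 1 := hz' U hU
      have hmono : U.valuation (z' ^ (𝒲.sup Nf + 1) * z₁) ≤ U.valuation (z' ^ Nf U * z₁) := by
        rw [map_mul, map_mul, map_pow, map_pow]
        exact mul_le_mul' (pow_le_pow_right_of_le_one' hzU.le hle) le_rfl
      exact lt_of_le_of_lt hmono (hNf U hU)
    obtain ⟨N, hN1, hNU⟩ := hN
    have hzN₀ : 1 < W₀.valuation (z' ^ N) := by
      rw [map_pow]; exact one_lt_pow₀ hz'₀ (Nat.one_le_iff_ne_zero.mp hN1)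
    rcases le_or_gt (W.valuation z') 1 with hle | hgt
    · -- `z = z'ᴺ z₁`
      refine ⟨z' ^ N * z₁, ?_, fun U hU => ?_⟩
      · rw [map_mul]
        exact one_lt_mul'' hzN₀ hz₁₀
      · rcases Finset.mem_insert.mp hU with rfl | hU
        · rw [map_mul, map_pow]
          refine lt_of_le_of_lt (mul_le_mul' (pow_le_one₀ zero_le hle) le_rfl) ?_
          rwa [one_mul]
        · exact hNU U hU
    · -- `z = z'ᴺ z₁ / (1 + z'ᴺ)`
      have hne : 1 + z' ^ N ≠ 0 := one_add_ne_zero_of_one_lt W₀ hzN₀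
      refine ⟨z' ^ N / (1 + z' ^ N) * z₁, ?_, fun U hU => ?_⟩
      · rw [map_mul, valuation_pow_div_one_add_pow_eq_one_of_one_lt W₀ hz'₀ hN1, one_mul]
        exact hz₁₀
      · rcases Finset.mem_insert.mp hU with rfl | hU
        · rw [map_mul, valuation_pow_div_one_add_pow_eq_one_of_one_lt U hgt hN1, one_mul]
          exact hz₁W
        · rw [map_mul, valuation_pow_div_one_add_pow_eq_of_lt_one U (hz' U hU) hN1, ← map_pow,
            ← map_mul]
          exact hNU U hU

/-- **The separating unit.** Under the same hypotheses there is `s ∈ L` with `|s|_{W₀} = 1` and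
`|s|_W < 1` for all `W ∈ 𝒲`: `s = z/(1 + z)`.
[cite: BourbakiAC5to7, Ch. VI §7 no. 2, Th. 1 and Cor. 1] -/
theorem exists_valuation_eq_one_and_forall_lt_one [DecidableEq (ValuationSubring L)]
    (W₀ : ValuationSubring L) (h₀ : ∃ t : L, 1 < W₀.valuation t)
    (𝒲 : Finset (ValuationSubring L)) (hinc : ∀ W ∈ 𝒲, ¬W₀ ≤ W ∧ ¬W ≤ W₀)
    (harch : ∀ W ∈ 𝒲, ∀ x y : L, W.valuation x < 1 → ∃ N : ℕ, W.valuation (x ^ N * y) < 1) :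
    ∃ s : L, W₀.valuation s = 1 ∧ ∀ W ∈ 𝒲, W.valuation s < 1 := by
  obtain ⟨z, hz₀, hz⟩ := exists_one_lt_valuation_and_forall_lt_one W₀ h₀ 𝒲 hinc harch
  refine ⟨z / (1 + z), valuation_div_one_add_eq_one_of_one_lt W₀ hz₀, fun W hW => ?_⟩
  rw [valuation_div_one_add_eq_of_lt_one W (hz W hW)]
  exact hz W hW

/-- The separating unit lies in `W₀` and in every `W ∈ 𝒲` (indeed in their maximal ideals), and is
a unit of `W₀`. [folklore] -/
theorem exists_unit_mem_forall_valuation_lt_one [DecidableEq (ValuationSubring L)]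
    (W₀ : ValuationSubring L) (h₀ : ∃ t : L, 1 < W₀.valuation t)
    (𝒲 : Finset (ValuationSubring L)) (hinc : ∀ W ∈ 𝒲, ¬W₀ ≤ W ∧ ¬W ≤ W₀)
    (harch : ∀ W ∈ 𝒲, ∀ x y : L, W.valuation x < 1 → ∃ N : ℕ, W.valuation (x ^ N * y) < 1) :
    ∃ s : L, s ∈ W₀ ∧ s⁻¹ ∈ W₀ ∧ W₀.valuation s = 1 ∧ ∀ W ∈ 𝒲, s ∈ W ∧ W.valuation s < 1 := by
  obtain ⟨s, hs₀, hs⟩ := exists_valuation_eq_one_and_forall_lt_one W₀ h₀ 𝒲 hinc harch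
  refine ⟨s, (W₀.valuation_le_one_iff s).mp hs₀.le, ?_, hs₀, fun W hW =>
    ⟨(W.valuation_le_one_iff s).mp (hs W hW).le, hs W hW⟩⟩
  rw [← W₀.valuation_le_one_iff, map_inv₀, hs₀, inv_one]

end Approximation

/-! ### The hypotheses from rank one -/

section RankOne

variable (W : ValuationSubring L)

/-- **Archimedean ⇒ the multiplicative form used above**: if for every `a` with `|a| > 1` and every
`b` some power `|a|ⁿ ≥ |b|` (rank one in Kuhlmann's value-group form), then for `|x| < 1` and any
`y` some `|xᴺ y| < 1`. [folklore] -/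
theorem archimedean_mul_of_forall_le_pow
    (hA : ∀ a b : L, 1 < W.valuation a → ∃ n : ℕ, W.valuation b ≤ W.valuation a ^ n)
    (x y : L) (hx : W.valuation x < 1) : ∃ N : ℕ, W.valuation (x ^ N * y) < 1 := by
  by_cases hx0 : x = 0
  · refine ⟨1, ?_⟩
    rw [hx0, pow_one, zero_mul, map_zero]
    exact zero_lt_one
  · have hvx : W.valuation x ≠ 0 := by rwa [Ne, Valuation.zero_iff]
    have hinv : 1 < W.valuation x⁻¹ := by
      rw [map_inv₀]; exact (one_lt_inv₀ ((Valuation.pos_iff _).mpr hx0)).mpr hx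
    obtain ⟨n, hn⟩ := hA x⁻¹ y hinv
    refine ⟨n + 1, ?_⟩
    rw [map_mul, map_pow, pow_succ, mul_assoc, mul_comm (W.valuation x) _, ← mul_assoc]
    -- `|x|ⁿ |y| ≤ |x|ⁿ |x⁻¹|ⁿ = 1`
    have hle : W.valuation x ^ n * W.valuation y ≤ 1 := by
      calc W.valuation x ^ n * W.valuation y
          ≤ W.valuation x ^ n * W.valuation x⁻¹ ^ n := mul_le_mul' le_rfl hn
        _ = 1 := by rw [map_inv₀, ← mul_pow, mul_inv_cancel₀ hvx, one_pow]
    calc W.valuation x ^ n * W.valuation y * W.valuation x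
        ≤ 1 * W.valuation x := mul_le_mul' hle le_rfl
      _ = W.valuation x := one_mul _
      _ < 1 := hx

/-- **Incomparability from height one.** If every valuation subring containing `W₀` is `W₀` or
all of `L` (height one), `W ≠ W₀` and `W ≠ ⊤`, then `¬ W₀ ≤ W`. [folklore] -/
theorem not_le_of_forall_le_imp {W₀ : ValuationSubring L}
    (hmax : ∀ S : ValuationSubring L, W₀ ≤ S → S = W₀ ∨ S = ⊤) (hne : W ≠ W₀) (htop : W ≠ ⊤) :
    ¬W₀ ≤ W := fun hle => by
  rcases hmax W hle with h | h
  · exact hne h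
  · exact htop h

/-- A valuation subring with a value `> 1` is not all of `L`. [folklore] -/
theorem ne_top_of_exists_one_lt (h : ∃ t : L, 1 < W.valuation t) : W ≠ ⊤ := by
  rintro rfl
  obtain ⟨t, ht⟩ := h
  have : (⊤ : ValuationSubring L).valuation t ≤ 1 :=
    ((⊤ : ValuationSubring L).valuation_le_one_iff t).mpr (ValuationSubring.mem_top t)
  exact not_lt_of_ge this ht

/-- **Incomparability of two distinct height-one valuation rings** (both directions).
[folklore] -/
theorem not_le_and_not_le_of_height_one {W₀ W : ValuationSubring L}
    (hmax₀ : ∀ S : ValuationSubring L, W₀ ≤ S → S = W₀ ∨ S = ⊤)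
    (hmax : ∀ S : ValuationSubring L, W ≤ S → S = W ∨ S = ⊤)
    (h₀ : ∃ t : L, 1 < W₀.valuation t) (h : ∃ t : L, 1 < W.valuation t) (hne : W ≠ W₀) :
    ¬W₀ ≤ W ∧ ¬W ≤ W₀ :=
  ⟨not_le_of_forall_le_imp W hmax₀ hne (ne_top_of_exists_one_lt W h),
    not_le_of_forall_le_imp W₀ hmax (Ne.symm hne) (ne_top_of_exists_one_lt W₀ h₀)⟩

end RankOne

end Literature.AlgebraicGeometry.Resolution

end
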